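import Literature.MathematicalPhysics.QuantumFieldTheory.Balaban1983to89.B6RandomWalkL2

/-!
# `Balaban1983to89.B6RandomWalkL2Chain` — T. Bałaban, *Propagators and renormalization transformations for lattice gauge theories. II*,
# Commun. Math. Phys. **96** (1984) 223–250 [Balaban1984PropagatorsII], (2.64)–(2.66) p. 234 and (2.141) p. 247 IN THE `L²` NORMS OF (2.140):
# the powers `Rⁿ`, the terms `G₀Rⁿ`, the partial sums and the fixed point `G = G₀ + GR` through block-`ℓ²` majorants (file 2 of 2, sequel of
# `…B6RandomWalkL2`; the `ℓ²` twin of `B6RandomWalk.majorant_pow_265` … `prop26_chain_2136`)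

statement-level skeleton of published theorems with citation tags; proofs where landed; nothing here is a claim about the Yang–Mills mass gap

WHAT IS PRINTED (p. 234 [PDF 12]): *"Applying this inequality to the n^th power of the operator R in (2.38) we have |(Rⁿλ)(x)| ≤ (O(M^{−1})c₁)ⁿ
e^{−½δ₀d(y,y′)}|λ|, (2.65) … |(G′λ)(x)| ≤ Σ_{n=0}^∞ |(G′₀Rⁿλ)(x)| ≤ … (2.66)"*; p. 247 [PDF 25] (render `inprint/lit-balaban-p05/renders/cmp96/p25.png`):
*"Reasoning in the same way as in the proof of Proposition 2.2 we obtain Proposition 2.6. … ‖ζGJ‖, ‖ζ∇GJ‖, ‖ζG∇*J‖, ‖ζ∇G∇*J‖, ‖ζ∇∇GJ‖, ‖ζG∇*∇*J‖ ≤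
O(1)[(Lʲη)², Lʲη, Lʲη, 1, 1, 1]|ζ|e^{−δ₃d(y,y′)}‖J‖ (2.140) … G = G₀(I − R)⁻¹ = Σ_{n=0}^∞ G₀Rⁿ = … (2.141) and the series above is convergent in the
norms appearing in the inequalities (2.136)–(2.140)."*

CITATION HEADER (lean-in-tree rule) — WHAT IS REPRODUCED.  Phase-2 file of the `lit-balaban` typed skeleton (HOME `run/shared/lean/pub/lit-balaban/`),
seat **p22 gen 29** (free-target protocol G.5-34(d), TAKING HOME/STATUS 2026-08-24T13:26Z, cc r03); SKELETON row **B6.Prop2.6** × B6.Eq2.141 × B6.Eq2.66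
(cells only; decls of record untouched).  The (2.64)–(2.66) chain of `B6RandomWalk` (section `Prop22Chain`) REPLAYED LINE BY LINE for the block-`ℓ²`
majorants `HasL2Majorant` of `…B6RandomWalkL2` — the kernel algebra (`chain_const_mul`, `Ineq261`, `Ineq263`, `c1`, `Triangle254`, `fixedPoint_telescope`,
`const2136`, `delta3`) BY NAME, only the operator link changes:
* §3 `kernel_G0_conv_le` (the kernel step of (2.66), isolated: split `e^{−δ₀d} = e^{−(1−α)δ₀d}e^{−αδ₀d}`, (2.54), (2.61)); **`l2Majorant_pow_265`** (`Rⁿ` has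
  the block-`ℓ²` majorant `(θc₁)ⁿe^{−(1−α)δ₀d}`); **`l2Majorant_G0_mul_265`** (one term `G₀T`); **`l2Majorant_partialSum_266`** (the partial sums
  `Σ_{n<N}G₀Rⁿ`, uniformly in `N` under `θc₁ < 1`); **`l2Majorant_of_fixedPoint_266`** (every `G′` with `G′ = G′₀ + G′R`: the remainder `G′R^N → 0` in `ℓ²`);
* §4 **`prop26_chain_2140`** — Prop. 2.6's *"reasoning in the same way as in the proof of Proposition 2.2"* for the `L²` entries of (2.140): at the rate `½δ₂`
  of (2.135), `G = G₀ + GR` ((2.91)/(2.141)) has the block-`ℓ²` majorant `const2136·P(y)·e^{−δ₃d(y,y′)}` (`δ₃ = delta3 α δ₂`) as soon as `G₀` and `R` have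
  the block-`ℓ²` majorants `A·P(y)·e^{−½δ₂d}` and `θe^{−½δ₂d}` with `θc₁ < 1` — *"the series above is convergent in the norms appearing in (2.136)–(2.140)"*.
THEOREMS ONLY (no definition, no `def … : Prop`, no new hypothesis beyond the printed shapes); standard axioms.

HONEST SCOPE / DIVERGENCES.  (1) As `B6RandomWalk`: the analytic inputs (block-`ℓ²` majorants of `G₀` and `R` — the `L²` legs of (2.141) from the member
bounds (1.114) of [Balaban1984PropagatorsI] and from (2.134)) are hypotheses OF THE PRINTED SHAPE, to be discharged by k-level member files; constants
`c₁` at the rate used, `δ₃ = (1 − α)·½δ₂`, `O(1) = A c₁(1 − θc₁)⁻¹` under the located smallness `θc₁ < 1` (*"M is sufficiently large"*).  (2) Unweighted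
`ℓ²` sums on both sides.  (3) This is bookkeeping toward the unowned census slots (2.140)₄₋₆, NOT those slots.  NOT summit progress.
Unit `lit-balaban-p22` (gen 29), 2026-08-24.
-/

noncomputable section

open scoped BigOperators
open Finset

namespace Literature.MathematicalPhysics.QuantumFieldTheory.Balaban1983to89.B6RandomWalkL2Chain

open B6RandomWalk (blockPiece sum_blockPiece chain chain_zero chain_succ chain_nonneg chain_const_mul
  Ineq261 Ineq263 Triangle254 c1_nonneg fixedPoint_telescope const2136 delta3)
open B6RandomWalkL2 (l2n l2n_nonneg l2n_zero l2n_add_le l2n_sum_le l2n_mono l2n_blockPiece_le blockPiece_add HasL2Majorant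
  hasL2Majorant_mono hasL2Majorant_sum hasL2Majorant_mul hasL2Majorant_pow_chain hasL2Majorant_one exists_l2OpBound l2n_apply_le_of_hasL2Majorant)

variable {g : B6.Geometry} {X : Type} [Fintype X]

/-! ## §3  (2.64)–(2.66) in the `L²` norms: the powers `Rⁿ`, one term `G₀Rⁿ`, the partial sums, the fixed point -/

section Chain266

variable (blk : X → g.Site)

/-- the KERNEL step of (2.66) (p. 234), isolated: `Σ_{y″} A·P(a)·e^{−δ₀d(a,y″)}·(r·e^{−(1−α)δ₀d(y″,b)}) ≤ A·c₁·P(a)·r·e^{−(1−α)δ₀d(a,b)}` — split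
`e^{−δ₀d(a,y″)} = e^{−(1−α)δ₀d(a,y″)}e^{−αδ₀d(a,y″)}`, pull `e^{−(1−α)δ₀d(a,b)}` out by the triangle inequality (2.54), and sum `e^{−αδ₀d(a,·)}` by (2.61).
[cite: Balaban1984PropagatorsII, (2.66) p.234 with (2.54) p.233, (2.61) p.234] -/
theorem kernel_G0_conv_le (d : ℕ) (δ₀ α A r : ℝ) (P : g.Site → ℝ) (hA : 0 ≤ A) (hP : ∀ y, 0 ≤ P y) (hr : 0 ≤ r)
    (hαδ : 0 ≤ (1 - α) * δ₀) (htri : Triangle254 g) (h261 : Ineq261 d g δ₀ α) (a b : g.Site) :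
    ∑ y'' : g.Site, A * P a * Real.exp (-(δ₀ * g.dist a y'')) * (r * Real.exp (-((1 - α) * δ₀ * g.dist y'' b))) ≤
      A * B6.c1 d δ₀ α * P a * r * Real.exp (-((1 - α) * δ₀ * g.dist a b)) := by
  have hterm : ∀ y'' : g.Site,
      A * P a * Real.exp (-(δ₀ * g.dist a y'')) * (r * Real.exp (-((1 - α) * δ₀ * g.dist y'' b))) ≤
        A * P a * r * Real.exp (-((1 - α) * δ₀ * g.dist a b)) * Real.exp (-(α * δ₀ * g.dist a y'')) := by
    intro y''
    have hexp : Real.exp (-(δ₀ * g.dist a y'')) * Real.exp (-((1 - α) * δ₀ * g.dist y'' b)) ≤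
        Real.exp (-((1 - α) * δ₀ * g.dist a b)) * Real.exp (-(α * δ₀ * g.dist a y'')) := by
      rw [← Real.exp_add, ← Real.exp_add]
      refine Real.exp_le_exp.mpr ?_
      have := mul_le_mul_of_nonneg_left (htri a y'' b) hαδ
      nlinarith
    have := mul_le_mul_of_nonneg_left hexp (mul_nonneg (mul_nonneg hA (hP a)) hr)
    calc A * P a * Real.exp (-(δ₀ * g.dist a y'')) * (r * Real.exp (-((1 - α) * δ₀ * g.dist y'' b)))
        = A * P a * r * (Real.exp (-(δ₀ * g.dist a y'')) * Real.exp (-((1 - α) * δ₀ * g.dist y'' b))) := by ring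
      _ ≤ A * P a * r * (Real.exp (-((1 - α) * δ₀ * g.dist a b)) * Real.exp (-(α * δ₀ * g.dist a y''))) := this
      _ = _ := by ring
  calc ∑ y'' : g.Site, A * P a * Real.exp (-(δ₀ * g.dist a y'')) * (r * Real.exp (-((1 - α) * δ₀ * g.dist y'' b)))
      ≤ ∑ y'' : g.Site, A * P a * r * Real.exp (-((1 - α) * δ₀ * g.dist a b)) *
          Real.exp (-(α * δ₀ * g.dist a y'')) := Finset.sum_le_sum fun y'' _ => hterm y''
    _ = A * P a * r * Real.exp (-((1 - α) * δ₀ * g.dist a b)) *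
          ∑ y'' : g.Site, Real.exp (-(α * δ₀ * g.dist a y'')) := by rw [Finset.mul_sum]
    _ ≤ A * P a * r * Real.exp (-((1 - α) * δ₀ * g.dist a b)) * B6.c1 d δ₀ α :=
        mul_le_mul_of_nonneg_left (h261 a)
          (mul_nonneg (mul_nonneg (mul_nonneg hA (hP a)) hr) (Real.exp_nonneg _))
    _ = A * B6.c1 d δ₀ α * P a * r * Real.exp (-((1 - α) * δ₀ * g.dist a b)) := by ring

/-- **(2.64) ⇒ (2.65) IN `L²`** (p. 234): from the block-`ℓ²` majorant `θe^{−δ₀d}` of `R` (`θ = O(M⁻¹) ≥ 0`) and (2.63) of Lemma 2.1, `Rⁿ` has the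
block-`ℓ²` majorant `(θc₁(α))ⁿe^{−(1−α)δ₀d(y,y′)}` for EVERY `n ≥ 0` (`n = 0`: `d(y,y) = 0` and `‖Δ(y)u‖ ≤ ‖u‖`).
[cite: Balaban1984PropagatorsII, (2.64)–(2.65) p.234, (2.141) p.247] -/
theorem l2Majorant_pow_265 (d : ℕ) (δ₀ α θ : ℝ) (hθ : 0 ≤ θ)
    (hrefl : ∀ y : g.Site, g.dist y y = 0) (h263 : Ineq263 d g δ₀ α)
    {R : Module.End ℝ (X → ℝ)} (hR : HasL2Majorant blk R (fun a b => θ * Real.exp (-(δ₀ * g.dist a b)))) (n : ℕ) :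
    HasL2Majorant blk (R ^ n) (fun a b => (θ * B6.c1 d δ₀ α) ^ n * Real.exp (-((1 - α) * δ₀ * g.dist a b))) := by
  cases n with
  | zero =>
      rw [pow_zero]
      refine hasL2Majorant_one blk (fun y => ?_) (fun a b => by positivity)
      simp [hrefl y]
  | succ m =>
      have hK : ∀ a b : g.Site, 0 ≤ θ * Real.exp (-(δ₀ * g.dist a b)) := fun a b => mul_nonneg hθ (Real.exp_nonneg _)
      refine hasL2Majorant_mono blk (hasL2Majorant_pow_chain blk hR hK m) fun a b => ?_
      rw [chain_const_mul, mul_pow, mul_assoc]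
      exact mul_le_mul_of_nonneg_left (h263 m a b) (pow_nonneg hθ _)

/-- **One term of (2.66) IN `L²`**: `G₀T` with the `G₀`-majorant `A·P(y)·e^{−δ₀d}` and `T`'s `r·e^{−(1−α)δ₀d}` has the block-`ℓ²` majorant
`A c₁(α) P(y) r e^{−(1−α)δ₀d(y,y′)}` (the `y″`-summation costs one factor `c₁(α)`, `kernel_G0_conv_le`). [cite: Balaban1984PropagatorsII, (2.66) p.234, (2.141) p.247] -/
theorem l2Majorant_G0_mul_265 (d : ℕ) (δ₀ α A r : ℝ) (P : g.Site → ℝ) (hA : 0 ≤ A)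
    (hP : ∀ y, 0 ≤ P y) (hr : 0 ≤ r) (hαδ : 0 ≤ (1 - α) * δ₀) (htri : Triangle254 g) (h261 : Ineq261 d g δ₀ α)
    {G0 T : Module.End ℝ (X → ℝ)}
    (hG0 : HasL2Majorant blk G0 (fun a b => A * P a * Real.exp (-(δ₀ * g.dist a b))))
    (hT : HasL2Majorant blk T (fun a b => r * Real.exp (-((1 - α) * δ₀ * g.dist a b)))) :
    HasL2Majorant blk (G0 * T)
      (fun a b => A * B6.c1 d δ₀ α * P a * r * Real.exp (-((1 - α) * δ₀ * g.dist a b))) := by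
  have hK₁ : ∀ a b : g.Site, 0 ≤ A * P a * Real.exp (-(δ₀ * g.dist a b)) := fun a b =>
    mul_nonneg (mul_nonneg hA (hP a)) (Real.exp_nonneg _)
  exact hasL2Majorant_mono blk (hasL2Majorant_mul blk hG0 hT hK₁)
    (fun a b => kernel_G0_conv_le d δ₀ α A r P hA hP hr hαδ htri h261 a b)

/-- **(2.66) IN `L²`, the partial sums of (2.50)/(2.141)**: every partial sum `Σ_{n<N}G₀Rⁿ` has the block-`ℓ²` majorant
`A c₁(α)(1 − θc₁(α))⁻¹ P(y) e^{−(1−α)δ₀d(y,y′)}`, UNIFORMLY in `N`, under the located smallness `θc₁(α) < 1` (*"M is sufficiently large"*).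
[cite: Balaban1984PropagatorsII, (2.66) p.234, (2.141) p.247] -/
theorem l2Majorant_partialSum_266 (d : ℕ) (δ₀ α θ A : ℝ) (P : g.Site → ℝ) (hA : 0 ≤ A)
    (hP : ∀ y, 0 ≤ P y) (hθ : 0 ≤ θ) (hαδ : 0 ≤ (1 - α) * δ₀) (htri : Triangle254 g)
    (hrefl : ∀ y : g.Site, g.dist y y = 0) (h261 : Ineq261 d g δ₀ α) (h263 : Ineq263 d g δ₀ α)
    (hsmall : θ * B6.c1 d δ₀ α < 1) {G0 R : Module.End ℝ (X → ℝ)}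
    (hG0 : HasL2Majorant blk G0 (fun a b => A * P a * Real.exp (-(δ₀ * g.dist a b))))
    (hR : HasL2Majorant blk R (fun a b => θ * Real.exp (-(δ₀ * g.dist a b)))) (N : ℕ) :
    HasL2Majorant blk (∑ n ∈ Finset.range N, G0 * R ^ n)
      (fun a b => A * B6.c1 d δ₀ α * (1 - θ * B6.c1 d δ₀ α)⁻¹ * P a *
        Real.exp (-((1 - α) * δ₀ * g.dist a b))) := by
  set q : ℝ := θ * B6.c1 d δ₀ α with hq
  have hq0 : 0 ≤ q := mul_nonneg hθ (c1_nonneg d δ₀ α)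
  have hterm : ∀ n, HasL2Majorant blk (G0 * R ^ n)
      (fun a b => A * B6.c1 d δ₀ α * P a * q ^ n * Real.exp (-((1 - α) * δ₀ * g.dist a b))) := fun n =>
    l2Majorant_G0_mul_265 blk d δ₀ α A (q ^ n) P hA hP (pow_nonneg hq0 n) hαδ htri h261 hG0
      (l2Majorant_pow_265 blk d δ₀ α θ hθ hrefl h263 hR n)
  refine hasL2Majorant_mono blk (hasL2Majorant_sum blk (fun n => G0 * R ^ n) _ hterm N) fun a b => ?_
  have hgeom : ∑ n ∈ Finset.range N, q ^ n ≤ (1 - q)⁻¹ :=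
    sum_le_hasSum (Finset.range N) (fun n _ => pow_nonneg hq0 n) (hasSum_geometric_of_lt_one hq0 hsmall)
  have hC : 0 ≤ A * B6.c1 d δ₀ α * P a * Real.exp (-((1 - α) * δ₀ * g.dist a b)) :=
    mul_nonneg (mul_nonneg (mul_nonneg hA (c1_nonneg d δ₀ α)) (hP a)) (Real.exp_nonneg _)
  calc ∑ n ∈ Finset.range N, A * B6.c1 d δ₀ α * P a * q ^ n * Real.exp (-((1 - α) * δ₀ * g.dist a b))
      = A * B6.c1 d δ₀ α * P a * Real.exp (-((1 - α) * δ₀ * g.dist a b)) * ∑ n ∈ Finset.range N, q ^ n := by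
        rw [Finset.mul_sum]; refine Finset.sum_congr rfl fun n _ => ?_; ring
    _ ≤ A * B6.c1 d δ₀ α * P a * Real.exp (-((1 - α) * δ₀ * g.dist a b)) * (1 - q)⁻¹ :=
        mul_le_mul_of_nonneg_left hgeom hC
    _ = _ := by ring

/-- **(2.66) ⇒ the operator itself, IN `L²`**: every `G′` on the finite lattice with `G′ = G′₀ + G′R` ((2.38)/(2.50), (2.91)/(2.141)) has the block-`ℓ²`
majorant `A c₁(α)(1 − θc₁(α))⁻¹ P(y) e^{−(1−α)δ₀d(y,y′)}`: the remainder `G′R^N` dies as `N → ∞` by (2.65) in `L²` and the `ℓ²`-boundedness of `G′`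
(*"the series above is convergent in the norms appearing in the inequalities (2.136)–(2.140)"*). [cite: Balaban1984PropagatorsII, (2.66) p.234, (2.141) p.247] -/
theorem l2Majorant_of_fixedPoint_266 [DecidableEq X] (d : ℕ) (δ₀ α θ A : ℝ) (P : g.Site → ℝ)
    (hA : 0 ≤ A) (hP : ∀ y, 0 ≤ P y) (hθ : 0 ≤ θ) (hαδ : 0 ≤ (1 - α) * δ₀) (htri : Triangle254 g)
    (hrefl : ∀ y : g.Site, g.dist y y = 0) (hdnn : ∀ y y' : g.Site, 0 ≤ g.dist y y')
    (h261 : Ineq261 d g δ₀ α) (h263 : Ineq263 d g δ₀ α) (hsmall : θ * B6.c1 d δ₀ α < 1)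
    {G' G0 R : Module.End ℝ (X → ℝ)}
    (hG0 : HasL2Majorant blk G0 (fun a b => A * P a * Real.exp (-(δ₀ * g.dist a b))))
    (hR : HasL2Majorant blk R (fun a b => θ * Real.exp (-(δ₀ * g.dist a b)))) (hfix : G' = G0 + G' * R) :
    HasL2Majorant blk G'
      (fun a b => A * B6.c1 d δ₀ α * (1 - θ * B6.c1 d δ₀ α)⁻¹ * P a *
        Real.exp (-((1 - α) * δ₀ * g.dist a b))) := by
  intro y y' u hu
  obtain ⟨E, hE, hEb⟩ := exists_l2OpBound G'
  set q : ℝ := θ * B6.c1 d δ₀ α with hq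
  have hq0 : 0 ≤ q := mul_nonneg hθ (c1_nonneg d δ₀ α)
  set C : ℝ := A * B6.c1 d δ₀ α * (1 - q)⁻¹ * P y * Real.exp (-((1 - α) * δ₀ * g.dist y y')) * l2n u with hC
  set S : ℝ := (Fintype.card g.Site : ℝ) with hS
  -- for every N: ‖Δ(y)G′u‖ ≤ C + E·S·q^N·‖u‖
  have hN : ∀ N : ℕ, l2n (blockPiece blk y (G' u)) ≤ C + E * S * l2n u * q ^ N := by
    intro N
    have hSum := l2Majorant_partialSum_266 blk d δ₀ α θ A P hA hP hθ hαδ htri hrefl h261 h263 hsmall hG0 hR N y y' u hu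
    have hRN := l2Majorant_pow_265 blk d δ₀ α θ hθ hrefl h263 hR N
    -- global ℓ² bound of R^N u: sum the pieces, drop e^{−(1−α)δ₀d} ≤ 1
    have hglob : l2n ((R ^ N) u) ≤ S * q ^ N * l2n u := by
      have h1 := l2n_apply_le_of_hasL2Majorant blk hRN y' u hu
      refine h1.trans (mul_le_mul_of_nonneg_right ?_ (l2n_nonneg u))
      calc ∑ z : g.Site, (θ * B6.c1 d δ₀ α) ^ N * Real.exp (-((1 - α) * δ₀ * g.dist z y'))
          ≤ ∑ _z : g.Site, q ^ N := Finset.sum_le_sum fun z _ => by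
            have : Real.exp (-((1 - α) * δ₀ * g.dist z y')) ≤ 1 := by
              rw [Real.exp_le_one_iff]
              have := mul_nonneg hαδ (hdnn z y')
              linarith
            simpa [hq] using mul_le_mul_of_nonneg_left this (pow_nonneg hq0 N)
        _ = S * q ^ N := by rw [Finset.sum_const, Finset.card_univ, nsmul_eq_mul]
    have hrem : l2n (blockPiece blk y ((G' * R ^ N) u)) ≤ E * (S * q ^ N * l2n u) := by
      rw [Module.End.mul_apply]
      exact (l2n_blockPiece_le blk y _).trans ((hEb _).trans (mul_le_mul_of_nonneg_left hglob hE))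
    have hsplit : blockPiece blk y (G' u) =
        blockPiece blk y ((∑ n ∈ Finset.range N, G0 * R ^ n) u) + blockPiece blk y ((G' * R ^ N) u) := by
      conv_lhs => rw [fixedPoint_telescope hfix N]
      rw [LinearMap.add_apply, blockPiece_add]
    rw [hsplit]
    refine (l2n_add_le _ _).trans ?_
    have h1 : l2n (blockPiece blk y ((∑ n ∈ Finset.range N, G0 * R ^ n) u)) ≤ C := by simpa [hC, hq] using hSum
    nlinarith [hrem, h1]
  -- let N → ∞
  have hlim : Filter.Tendsto (fun N : ℕ => C + E * S * l2n u * q ^ N) Filter.atTop (nhds (C + E * S * l2n u * 0)) :=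
    ((tendsto_pow_atTop_nhds_zero_of_lt_one hq0 hsmall).const_mul (E * S * l2n u)).const_add C
  rw [mul_zero, add_zero] at hlim
  have := ge_of_tendsto' hlim hN
  simpa [hC, hq] using this

end Chain266

/-! ## §4  Proposition 2.6, the `L²` entries: "reasoning in the same way as in the proof of Proposition 2.2" at the rate `½δ₂` -/

section Prop26Chain

variable (blk : X → g.Site)

/-- **Prop. 2.6, the `L²` entries of (2.140), by "reasoning in the same way as in the proof of Proposition 2.2"** (p. 247) — the block-`ℓ²` instance of
`l2Majorant_of_fixedPoint_266` at the rate `½δ₂` of (2.135): if `R` has the block-`ℓ²` majorant `θe^{−½δ₂d(y,y′)}` (`θ = O(M⁻¹) ≥ 0`), `G₀ = Σ_□ h_□G_□h_□`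
the block-`ℓ²` majorant `A·P(y)·e^{−½δ₂d}` (the `L²` legs of (2.141); `P(y) = (Lʲη)², Lʲη, Lʲη, 1, 1, 1` for the six entries), Lemma 2.1 holds at the rate `½δ₂`,
`θ·c₁ < 1` (inherited M-largeness) and `G = G₀ + GR` ((2.91), i.e. (2.141)), then `G` has the block-`ℓ²` majorant `const2136·P(y)·e^{−δ₃d(y,y′)}` with
`δ₃ = delta3 α δ₂` — *"the series above is convergent in the norms appearing in the inequalities (2.136)–(2.140)"*.
[cite: Balaban1984PropagatorsII, Prop. 2.6 (2.140)–(2.141) p.247] -/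
theorem prop26_chain_2140 [DecidableEq X] (d : ℕ) (δ₂ α θ A : ℝ)
    (P : g.Site → ℝ) (hA : 0 ≤ A) (hP : ∀ y, 0 ≤ P y) (hθ : 0 ≤ θ) (hα : α ≤ 1) (hδ₂ : 0 ≤ δ₂)
    (htri : Triangle254 g) (hrefl : ∀ y : g.Site, g.dist y y = 0) (hdnn : ∀ y y' : g.Site, 0 ≤ g.dist y y')
    (h261 : Ineq261 d g (δ₂ / 2) α) (h263 : Ineq263 d g (δ₂ / 2) α) (hsmall : θ * B6.c1 d (δ₂ / 2) α < 1)
    {G G0 R : Module.End ℝ (X → ℝ)}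
    (hG0 : HasL2Majorant blk G0 (fun a b => A * P a * Real.exp (-(δ₂ / 2 * g.dist a b))))
    (hR : HasL2Majorant blk R (fun a b => θ * Real.exp (-(δ₂ / 2 * g.dist a b)))) (hfix : G = G0 + G * R) :
    HasL2Majorant blk G (fun a b => const2136 d δ₂ α θ A * P a * Real.exp (-(delta3 α δ₂ * g.dist a b))) := by
  have hαδ : 0 ≤ (1 - α) * (δ₂ / 2) := mul_nonneg (by linarith) (by linarith)
  have h := l2Majorant_of_fixedPoint_266 blk d (δ₂ / 2) α θ A P hA hP hθ hαδ htri hrefl hdnn h261 h263 hsmall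
    hG0 hR hfix
  intro y y' u hu
  have := h y y' u hu
  simpa [const2136, delta3, mul_assoc] using this

end Prop26Chain

end Literature.MathematicalPhysics.QuantumFieldTheory.Balaban1983to89.B6RandomWalkL2Chain
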